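import Summits.Ventures.HodgeRepro2.T5SU11WeightedSpaceGroundStateIterateDiff

/-!
# The derivative of the iterates of the resolvent: `d/dμ (L − μ)^{−n} = n (L − μ)^{−n−1}` on `W_1`

For `g ∈ W_1 = {|g| ≤ D Ξ}` the difference `D_n = (G^I_λ)ⁿ g − (G^I_{λ₂})ⁿ g` satisfies row 568's recursion
`D_{n+1} = G^I_λ D_n + (μ − μ₂) G^I_λ h_n`, `h_n = (G^I_{λ₂})^{n+1} g`. Writing `D_n = (μ − μ₂) n h_n + R_n` (the first-order
Taylor expansion with remainder) the recursion becomes `R_{n+1} = G^I_λ R_n + (μ − μ₂)(n + 1) (G^I_λ h_n − G^I_{λ₂} h_n)`, and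
row 556's sharp bound with row 557's Lipschitz bound give, with `m = min((λ − 1)², (λ₂ − 1)²)`:

* `abs_iterate_sub_sub_le` — **`|D_n(t) − (μ − μ₂) n (G^I_{λ₂})^{n+1} g(t)| ≤ (μ − μ₂)² · (n(n+1)/2) D Ξ(t)/m^{n+2}`** — the
  second-order remainder of the iterates, uniformly in `t` in the `Ξ`-weighted norm;
* `hasDerivAt_iterate_lam`, `deriv_iterate_lam` — **`λ ↦ (G^I_λ)ⁿ g(t)` has derivative `(2λ₂ − 2) · n · (G^I_{λ₂})^{n+1} g(t)`
  at every `λ₂ > 1`** — since `dμ/dλ = 2λ − 2`, this is `d/dμ (L − μ)^{−n} g = n (L − μ)^{−n−1} g`, and by induction the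
  Taylor coefficients of row 559's power series `Σ (μ − μ₂)^k (G^I_{λ₂})^{k+1} g` are the derivatives `dⁿ/dμⁿ (L − μ)⁻¹/n!`.

Nothing is claimed about (N).

Blind lane: Mathlib + the HodgeRepro2 prefix only; no sorry; axioms ⊆ {propext, Classical.choice,
Quot.sound}.
-/

namespace Summit.Ventures.HodgeRepro2.T5SU11ResolventIterateDerivative

open Filter Topology MeasureTheory
open Set (Ioi Ioc)
open T5SU11Cartan T5SU11SphericalFunction T5SU11SphericalDecay T5SU11RadialGreenImproper T5SU11SphericalBounds
  T5SU11ResolventGroundStateWeight T5SU11WeightedSpaceGroundState T5SU11WeightedSpaceGroundStateOrder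
  T5SU11WeightedSpaceGroundStateIterateDiff

section measure

variable [MeasurableSpace Circle] [BorelSpace Circle]

variable {lam lam₂ : ℝ} (hlam : 1 < lam) (hlam₂ : 1 < lam₂) {g : ℝ → ℝ} (hg : ContinuousOn g (Ioi 0))
  {D : ℝ} (hD : ∀ s, 0 < s → |g s| ≤ D * sph 1 (hyp s))

include hlam hlam₂ hg hD in
/-- **THE SECOND-ORDER REMAINDER OF THE ITERATES**: with `m = min((λ − 1)², (λ₂ − 1)²)`,
`|((G^I_λ)ⁿ g(t) − (G^I_{λ₂})ⁿ g(t)) − (μ − μ₂) · n · (G^I_{λ₂})^{n+1} g(t)| ≤ (μ − μ₂)² · (n(n+1)/2) · D Ξ(t)/m^{n+2}`. -/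
theorem abs_iterate_sub_sub_le (n : ℕ) {t : ℝ} (ht : 0 < t) :
    |(((greenSolI (fun t => sph lam (hyp t)) (sphDecay lam))^[n] g) t
        - ((greenSolI (fun t => sph lam₂ (hyp t)) (sphDecay lam₂))^[n] g) t)
        - (lam * (lam - 2) - lam₂ * (lam₂ - 2))
          * (n * ((greenSolI (fun t => sph lam₂ (hyp t)) (sphDecay lam₂))^[n + 1] g) t)|
      ≤ (lam * (lam - 2) - lam₂ * (lam₂ - 2)) ^ 2 * ((n * (n + 1) / 2) * D * sph 1 (hyp t)
        / (min ((lam - 1) ^ 2) ((lam₂ - 1) ^ 2)) ^ (n + 2)) := by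
  set m := min ((lam - 1) ^ 2) ((lam₂ - 1) ^ 2) with hm
  set κ := lam * (lam - 2) - lam₂ * (lam₂ - 2) with hκ
  have hp1 : 0 < (lam - 1) ^ 2 := by
    have : 0 < lam - 1 := by linarith
    positivity
  have hp2 : 0 < (lam₂ - 1) ^ 2 := by
    have : 0 < lam₂ - 1 := by linarith
    positivity
  have hm0 : 0 < m := lt_min hp1 hp2
  have hm1 : m ≤ (lam - 1) ^ 2 := min_le_left _ _
  have hm2 : m ≤ (lam₂ - 1) ^ 2 := min_le_right _ _
  have hD0 : 0 ≤ D := (class_of_le_mul_sph_one hlam hD).2.1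
  have hκ2 : 0 ≤ κ ^ 2 := sq_nonneg _
  suffices h : ∀ t, 0 < t → |(((greenSolI (fun t => sph lam (hyp t)) (sphDecay lam))^[n] g) t
        - ((greenSolI (fun t => sph lam₂ (hyp t)) (sphDecay lam₂))^[n] g) t)
        - κ * (n * ((greenSolI (fun t => sph lam₂ (hyp t)) (sphDecay lam₂))^[n + 1] g) t)|
      ≤ (κ ^ 2 * ((n * (n + 1) / 2) * D / m ^ (n + 2))) * sph 1 (hyp t) by
    have := h t ht
    calc _ ≤ (κ ^ 2 * ((n * (n + 1) / 2) * D / m ^ (n + 2))) * sph 1 (hyp t) := this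
      _ = _ := by ring
  induction n with
  | zero => intro t ht; simp
  | succ n ih =>
    intro t ht
    -- the data: `h = (G^I_{λ₂})^{n+1} g ∈ W_1`, the iterates at `λ` and `λ₂`, the remainder `R`
    obtain ⟨hch, hbh⟩ := iterate_mem_weighted_one hlam₂ hg hD (n + 1)
    obtain ⟨hc₁, _⟩ := iterate_mem_weighted_one hlam hg hD n
    obtain ⟨hc₂, _⟩ := iterate_mem_weighted_one hlam₂ hg hD n
    set h : ℝ → ℝ := (greenSolI (fun t => sph lam₂ (hyp t)) (sphDecay lam₂))^[n + 1] g with hh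
    set R : ℝ → ℝ := fun s => (((greenSolI (fun t => sph lam (hyp t)) (sphDecay lam))^[n] g) s
        - ((greenSolI (fun t => sph lam₂ (hyp t)) (sphDecay lam₂))^[n] g) s) - κ * (n * h s) with hR
    have hRc : ContinuousOn R (Ioi 0) :=
      (hc₁.sub hc₂).sub (continuousOn_const.mul (continuousOn_const.mul hch))
    have hRb : ∀ s, 0 < s → |R s| ≤ (κ ^ 2 * ((n * (n + 1) / 2) * D / m ^ (n + 2))) * sph 1 (hyp s) :=
      fun s hs => ih s hs
    have hDh : ∀ s, 0 < s → |h s| ≤ (D / ((lam₂ - 1) ^ 2) ^ (n + 1)) * sph 1 (hyp s) := fun s hs => by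
      rw [div_mul_eq_mul_div]; exact hbh s hs
    have hDκh : ∀ s, 0 < s → |(fun s => (κ * n) * h s) s| ≤ (|κ * n| * (D / ((lam₂ - 1) ^ 2) ^ (n + 1))) * sph 1 (hyp s) :=
      fun s hs => by
        simp only
        rw [abs_mul, mul_assoc]
        exact mul_le_mul_of_nonneg_left (hDh s hs) (abs_nonneg _)
    -- the decomposition `D_n = R + (κ n) h` and the recursion
    have hdec : (fun s => ((greenSolI (fun t => sph lam (hyp t)) (sphDecay lam))^[n] g) s
        - ((greenSolI (fun t => sph lam₂ (hyp t)) (sphDecay lam₂))^[n] g) s) = fun s => R s + (κ * n) * h s := by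
      funext s; simp only [hR]; ring
    have hcκh : ContinuousOn (fun s => (κ * n) * h s) (Ioi 0) := continuousOn_const.mul hch
    have hlin := greenSolI_add_ground hlam hRc hcκh hRb hDκh ht
    have hrec := iterate_sub_succ hlam hlam₂ hg hD n ht
    rw [hdec, hlin, greenSolI_const_mul_source] at hrec
    -- `(G^I_{λ₂})^{n+2} g = G^I_{λ₂} h`
    have hnext : ((greenSolI (fun t => sph lam₂ (hyp t)) (sphDecay lam₂))^[n + 1 + 1] g) t
        = greenSolI (fun t => sph lam₂ (hyp t)) (sphDecay lam₂) h t := by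
      rw [Function.iterate_succ_apply']
    -- the two estimates
    have h1 := abs_greenSolI_le_mul_sph_one' hlam hRc hRb ht
    have h2 := abs_greenSolI_sub_le_mul_sph_one hlam hch hDh hlam₂ ht
    have hΞ : 0 < sph 1 (hyp t) := sph_hyp_pos 1 t
    -- the target as `G^I_λ R + κ (n+1) (G^I_λ h − G^I_{λ₂} h)`
    have e : (((greenSolI (fun t => sph lam (hyp t)) (sphDecay lam))^[n + 1] g) t
          - ((greenSolI (fun t => sph lam₂ (hyp t)) (sphDecay lam₂))^[n + 1] g) t)
          - κ * (((n + 1 : ℕ) : ℝ) * ((greenSolI (fun t => sph lam₂ (hyp t)) (sphDecay lam₂))^[n + 1 + 1] g) t)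
        = greenSolI (fun t => sph lam (hyp t)) (sphDecay lam) R t
          + (κ * (n + 1)) * (greenSolI (fun t => sph lam (hyp t)) (sphDecay lam) h t
            - greenSolI (fun t => sph lam₂ (hyp t)) (sphDecay lam₂) h t) := by
      rw [hrec, hnext]
      push_cast
      ring
    rw [e]
    -- monotonicity of the constants in `m`
    have hmn2 : 0 < m ^ (n + 2) := pow_pos hm0 _
    have hmn3 : 0 < m ^ (n + 3) := pow_pos hm0 _
    have hA : κ ^ 2 * (n * (n + 1) / 2 * D / m ^ (n + 2)) * sph 1 (hyp t) / (lam - 1) ^ 2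
        ≤ κ ^ 2 * (n * (n + 1) / 2 * D / m ^ (n + 3)) * sph 1 (hyp t) := by
      have e1 : κ ^ 2 * (n * (n + 1) / 2 * D / m ^ (n + 2)) * sph 1 (hyp t) / (lam - 1) ^ 2
          = (κ ^ 2 * (n * (n + 1) / 2 * D) * sph 1 (hyp t)) / (m ^ (n + 2) * (lam - 1) ^ 2) := by
        field_simp
      have e2 : κ ^ 2 * (n * (n + 1) / 2 * D / m ^ (n + 3)) * sph 1 (hyp t)
          = (κ ^ 2 * (n * (n + 1) / 2 * D) * sph 1 (hyp t)) / m ^ (n + 3) := by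
        field_simp
      rw [e1, e2]
      apply div_le_div_of_nonneg_left (by positivity) hmn3
      calc m ^ (n + 3) = m ^ (n + 2) * m := pow_succ m (n + 2)
        _ ≤ m ^ (n + 2) * (lam - 1) ^ 2 := mul_le_mul_of_nonneg_left hm1 hmn2.le
    have hB : |κ * (n + 1)| * (|κ| * (D / ((lam₂ - 1) ^ 2) ^ (n + 1)) * sph 1 (hyp t)
          / ((lam - 1) ^ 2 * (lam₂ - 1) ^ 2))
        ≤ κ ^ 2 * ((n + 1) * D / m ^ (n + 3)) * sph 1 (hyp t) := by
      have hn1 : (0 : ℝ) ≤ n + 1 := by positivity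
      rw [abs_mul, abs_of_nonneg hn1]
      have e1 : |κ| * (n + 1) * (|κ| * (D / ((lam₂ - 1) ^ 2) ^ (n + 1)) * sph 1 (hyp t)
            / ((lam - 1) ^ 2 * (lam₂ - 1) ^ 2))
          = (κ ^ 2 * ((n + 1) * D) * sph 1 (hyp t)) / (((lam₂ - 1) ^ 2) ^ (n + 1) * ((lam - 1) ^ 2 * (lam₂ - 1) ^ 2)) := by
        rw [← sq_abs κ]
        field_simp
      have e2 : κ ^ 2 * ((n + 1) * D / m ^ (n + 3)) * sph 1 (hyp t)
          = (κ ^ 2 * ((n + 1) * D) * sph 1 (hyp t)) / m ^ (n + 3) := by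
        field_simp
      rw [e1, e2]
      apply div_le_div_of_nonneg_left (by positivity) hmn3
      calc m ^ (n + 3) = m ^ (n + 1) * (m * m) := by ring
        _ ≤ ((lam₂ - 1) ^ 2) ^ (n + 1) * ((lam - 1) ^ 2 * (lam₂ - 1) ^ 2) :=
          mul_le_mul (pow_le_pow_left₀ hm0.le hm2 _) (mul_le_mul hm1 hm2 hm0.le hp1.le) (by positivity)
            (by positivity)
    calc |greenSolI (fun t => sph lam (hyp t)) (sphDecay lam) R t
          + (κ * (n + 1)) * (greenSolI (fun t => sph lam (hyp t)) (sphDecay lam) h t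
            - greenSolI (fun t => sph lam₂ (hyp t)) (sphDecay lam₂) h t)|
        ≤ |greenSolI (fun t => sph lam (hyp t)) (sphDecay lam) R t|
          + |κ * (n + 1)| * |greenSolI (fun t => sph lam (hyp t)) (sphDecay lam) h t
            - greenSolI (fun t => sph lam₂ (hyp t)) (sphDecay lam₂) h t| := by
          rw [← abs_mul]; exact abs_add_le _ _
      _ ≤ κ ^ 2 * (n * (n + 1) / 2 * D / m ^ (n + 2)) * sph 1 (hyp t) / (lam - 1) ^ 2
          + |κ * (n + 1)| * (|κ| * (D / ((lam₂ - 1) ^ 2) ^ (n + 1)) * sph 1 (hyp t)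
            / ((lam - 1) ^ 2 * (lam₂ - 1) ^ 2)) := by
          refine add_le_add h1 (mul_le_mul_of_nonneg_left ?_ (abs_nonneg _))
          calc |greenSolI (fun t => sph lam (hyp t)) (sphDecay lam) h t
                - greenSolI (fun t => sph lam₂ (hyp t)) (sphDecay lam₂) h t|
              ≤ |κ| * (D / ((lam₂ - 1) ^ 2) ^ (n + 1)) * sph 1 (hyp t) / ((lam - 1) ^ 2 * (lam₂ - 1) ^ 2) := h2
            _ = _ := by ring
      _ ≤ κ ^ 2 * (n * (n + 1) / 2 * D / m ^ (n + 3)) * sph 1 (hyp t)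
          + κ ^ 2 * ((n + 1) * D / m ^ (n + 3)) * sph 1 (hyp t) := add_le_add hA hB
      _ = (κ ^ 2 * ((((n + 1 : ℕ) : ℝ) * ((n + 1 : ℕ) + 1) / 2) * D / m ^ (n + 1 + 2))) * sph 1 (hyp t) := by
          push_cast
          ring

include hlam₂ hg hD in
/-- **THE DERIVATIVE OF THE ITERATES OF THE RESOLVENT ON `W_1`**: `λ ↦ (G^I_λ)ⁿ g(t)` has the derivative
`(2λ₂ − 2) · n · (G^I_{λ₂})^{n+1} g(t)` at every `λ₂ > 1` — `d/dμ (L − μ)^{−n} = n (L − μ)^{−n−1}`. -/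
theorem hasDerivAt_iterate_lam (n : ℕ) {t : ℝ} (ht : 0 < t) :
    HasDerivAt (fun l => ((greenSolI (fun t => sph l (hyp t)) (sphDecay l))^[n] g) t)
      ((2 * lam₂ - 2) * (n * ((greenSolI (fun t => sph lam₂ (hyp t)) (sphDecay lam₂))^[n + 1] g) t)) lam₂ := by
  rw [hasDerivAt_iff_tendsto_slope]
  set X := ((greenSolI (fun t => sph lam₂ (hyp t)) (sphDecay lam₂))^[n + 1] g) t with hX
  have hp2 : 0 < (lam₂ - 1) ^ 2 := by
    have : 0 < lam₂ - 1 := by linarith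
    positivity
  -- the main term `(l + λ₂ − 2) n X → (2λ₂ − 2) n X`
  have hmain : Tendsto (fun l : ℝ => (l + lam₂ - 2) * (n * X)) (𝓝 lam₂) (𝓝 ((2 * lam₂ - 2) * (n * X))) := by
    have hcont : Continuous (fun l : ℝ => (l + lam₂ - 2) * (n * X)) := by fun_prop
    have h := hcont.tendsto lam₂
    simpa only [show lam₂ + lam₂ - 2 = 2 * lam₂ - 2 by ring] using h
  -- the remainder term `R_n(l)(t)/(l − λ₂) → 0`, from the second-order bound
  have hc : ContinuousAt (fun l : ℝ => |l - lam₂| * (l + lam₂ - 2) ^ 2 * ((n * (n + 1) / 2) * D * sph 1 (hyp t)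
      / (min ((l - 1) ^ 2) ((lam₂ - 1) ^ 2)) ^ (n + 2))) lam₂ := by
    apply ContinuousAt.mul
    · exact (continuousAt_id.sub continuousAt_const).abs.mul
        (((continuousAt_id.add continuousAt_const).sub continuousAt_const).pow 2)
    · apply ContinuousAt.div continuousAt_const
      · exact (((continuousAt_id.sub continuousAt_const).pow 2).min continuousAt_const).pow (n + 2)
      · simp only [min_self]
        positivity
  have hbound : Tendsto (fun l : ℝ => |l - lam₂| * (l + lam₂ - 2) ^ 2 * ((n * (n + 1) / 2) * D * sph 1 (hyp t)
      / (min ((l - 1) ^ 2) ((lam₂ - 1) ^ 2)) ^ (n + 2))) (𝓝 lam₂) (𝓝 0) := by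
    have h := hc.tendsto
    simpa only [sub_self, abs_zero, zero_mul] using h
  have hrem : Tendsto (fun l : ℝ => ((((greenSolI (fun t => sph l (hyp t)) (sphDecay l))^[n] g) t
        - ((greenSolI (fun t => sph lam₂ (hyp t)) (sphDecay lam₂))^[n] g) t)
        - (l * (l - 2) - lam₂ * (lam₂ - 2)) * (n * X)) / (l - lam₂)) (𝓝[≠] lam₂) (𝓝 0) := by
    refine squeeze_zero_norm' ?_ (tendsto_nhdsWithin_of_tendsto_nhds hbound)
    have hev : ∀ᶠ l in 𝓝[≠] lam₂, 1 < l := eventually_nhdsWithin_of_eventually_nhds (eventually_gt_nhds hlam₂)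
    filter_upwards [hev, self_mem_nhdsWithin] with l hl hne
    have hne' : l - lam₂ ≠ 0 := sub_ne_zero.mpr (Set.mem_compl_singleton_iff.mp hne)
    have hb := abs_iterate_sub_sub_le hl hlam₂ hg hD n ht
    rw [Real.norm_eq_abs, abs_div]
    rw [div_le_iff₀ (abs_pos.mpr hne')]
    calc |(((greenSolI (fun t => sph l (hyp t)) (sphDecay l))^[n] g) t
          - ((greenSolI (fun t => sph lam₂ (hyp t)) (sphDecay lam₂))^[n] g) t)
          - (l * (l - 2) - lam₂ * (lam₂ - 2)) * (n * X)|
        ≤ (l * (l - 2) - lam₂ * (lam₂ - 2)) ^ 2 * ((n * (n + 1) / 2) * D * sph 1 (hyp t)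
          / (min ((l - 1) ^ 2) ((lam₂ - 1) ^ 2)) ^ (n + 2)) := hb
      _ = |l - lam₂| * (l + lam₂ - 2) ^ 2 * ((n * (n + 1) / 2) * D * sph 1 (hyp t)
          / (min ((l - 1) ^ 2) ((lam₂ - 1) ^ 2)) ^ (n + 2)) * |l - lam₂| := by
          have e : l * (l - 2) - lam₂ * (lam₂ - 2) = (l - lam₂) * (l + lam₂ - 2) := by ring
          rw [e, mul_pow, ← sq_abs (l - lam₂)]
          ring
  -- assemble: the slope is the main term plus the remainder term
  have hsum := (tendsto_nhdsWithin_of_tendsto_nhds hmain).add hrem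
  rw [add_zero] at hsum
  refine hsum.congr' ?_
  have hev : ∀ᶠ l in 𝓝[≠] lam₂, 1 < l := eventually_nhdsWithin_of_eventually_nhds (eventually_gt_nhds hlam₂)
  filter_upwards [hev, self_mem_nhdsWithin] with l _ hne
  have hne' : l - lam₂ ≠ 0 := sub_ne_zero.mpr (Set.mem_compl_singleton_iff.mp hne)
  simp only [slope_def_field]
  have e : l * (l - 2) - lam₂ * (lam₂ - 2) = (l - lam₂) * (l + lam₂ - 2) := by ring
  rw [e]
  field_simp
  ring

include hlam₂ hg hD in
/-- **`deriv (λ ↦ (G^I_λ)ⁿ g(t)) λ₂ = (2λ₂ − 2) · n · (G^I_{λ₂})^{n+1} g(t)`** on `W_1`. -/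
theorem deriv_iterate_lam (n : ℕ) {t : ℝ} (ht : 0 < t) :
    deriv (fun l => ((greenSolI (fun t => sph l (hyp t)) (sphDecay l))^[n] g) t) lam₂
      = (2 * lam₂ - 2) * (n * ((greenSolI (fun t => sph lam₂ (hyp t)) (sphDecay lam₂))^[n + 1] g) t) :=
  (hasDerivAt_iterate_lam hlam₂ hg hD n ht).deriv

end measure

end Summit.Ventures.HodgeRepro2.T5SU11ResolventIterateDerivative
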